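import Mathlib.Geometry.Manifold.IsManifold.InteriorBoundary
import Literature.Topology.FourManifolds.CorkTwist
import Literature.Topology.FourManifolds.CerfGammaFourProofs
import HarnessLib

/-!
# The cork decomposition theorem: Matveyev's printed form and its reduction to `corkDecomposition`

Topic `Literature/Topology/FourManifolds` (fact item `provefact-Literature.corkDecomposition`; sibling of
`CorkTwist.lean`, which states the named fact `Literature.Topology.FourManifolds.corkDecomposition`).

## What this file does

`Literature.Topology.FourManifolds.corkDecomposition` (file `CorkTwist.lean`) renders the cork theorem in the *one-piece* form
"`X₁ = C ∪_φ W`, `X₂ = C ∪_{φ ∘ τ} W` for a compact contractible `C` and a self-diffeomorphism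
`τ` of `∂C`". The printed source states it in a *two-piece* form (Matveyev writes `M ♯_Σ Wᵢ` for
the union of `M` and `Wᵢ` along their common boundary `Σ`):

> **Theorem** (Matveyev, J. Differential Geom. 44 (1996) 571–582, Introduction;
> arXiv:dg-ga/9505001, p. 1). *Let `U` be a smooth, 5-dimensional, simply-connected h-cobordism with
> `∂U = M₁ ⊔ (−M₂)`. 1. There are decompositions `M₁ = M ♯_Σ W₁`, `M₂ = M ♯_Σ W₂` [compatible
> in `H₂` with the homotopy equivalence `f_*` induced by `U`], where `W₁`, `W₂` are smooth,
> compact, contractible 4-manifolds and `Σ = ∂W₁ = ∂W₂ = ∂M`. 2. These decompositions may be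
> chosen so that `W₁` is diffeomorphic to `W₂`.*

(Independently: Curtis–Freedman–Hsiang–Stong, Invent. Math. 123 (1996) 343–348, Theorem — the
sub-h-cobordism form of part 1; exposition of both in R. Kirby, *Akbulut's corks and h-cobordisms
of smooth simply connected 4-manifolds*, Turkish J. Math. 20 (1996), arXiv:math/9712231, Theorem
and Addendum (D).)

This file

* vendors the printed statement, **parts 1–2 minus the `H₂`-compatibility clause of part 1**
  (exactly the clause `corkDecomposition` omits), as the named fact
  `Literature.Topology.FourManifolds.Matveyev1996_decomposition`, and
* **proves**
  `Literature.corkDecomposition_of_matveyev1996 : Matveyev1996_decomposition → corkDecomposition`: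
  transport the gluing `X₂ = W₂ ∪_{φ₂} M` along the diffeomorphism `g : W₁ ≅ W₂` of part 2, so
  that `X₂ = W₁ ∪_{φ₂ ∘ ∂g} M`, and take `C = W₁`, `τ = ∂g ≫ φ₂ ≫ φ₁⁻¹`;
  and the converse up to the instances `IsCorkTwist` does not record on the exterior:
  `Literature.Topology.FourManifolds.corkDecomposition_iff_matveyev1996Weak` states `corkDecomposition` equivalent
  to the *weak two-piece form* of Matveyev's theorem — `Matveyev1996_decomposition` with only a
  topology, a half-space atlas and a boundary datum recorded on the common exterior `M` — spelled
  out on its right-hand side (faithfulness certificate for the one-piece phrasing).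

**Merge note (2026-08-15, D-0026).** The weak two-piece form was first vendored as a separate
`[folklore]`-tagged `def Matveyev1996_decompositionWeak : Prop` (with `Matveyev1996_decomposition.weak`,
`corkDecomposition_of_matveyev1996Weak`, `matveyev1996Weak_of_corkDecomposition`). Its own
docstring said *"intermediate reformulation — not a further citable fact"*, nothing outside this
file used it, and by the two implications proved here it was unconditionally equivalent to
`corkDecomposition`: under the tree's accounting (every closed tagged `Prop` definition is a named
fact with a prove-seat until `_holds` lands) it was one proof obligation — the cork theorem —
counted twice, its seat able to end only in `blocked: needs corkDecomposition`. It is merged back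
exactly as the handlebody form `Matveyev1996_partOne_and_fact_of_two_three` was
(`CorkDecompositionHandlebody.lean`, History): the `def` and its three one-line companions are
withdrawn, the proposition survives verbatim as the right-hand side of
`corkDecomposition_iff_matveyev1996Weak`, and `corkDecomposition_of_matveyev1996` is proved through
it. No statement of a surviving declaration changed; no fact is introduced.

The reduction needs one piece of general differential topology, proved here in §1:

* `Literature.Topology.FourManifolds.BoundaryData.restrictDiffeomorph`: a diffeomorphism `g : C₁ ≅ C₂` of manifolds with
  boundary restricts to a diffeomorphism `∂g` of any boundary data `b₁`, `b₂` with
  `b₂.incl ∘ ∂g = g ∘ b₁.incl` — from Mathlib's `Diffeomorph.image_boundary` (invariance of the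
  boundary) and `ContMDiff.iff_comp_isImmersion` (smooth maps factor smoothly through
  immersions). With `g = id` this **discharges the tree's named fact**
  `Literature.Topology.FourManifolds.BoundaryData.nonempty_diffeomorph` (`Cobordism.lean`: any two boundary data of the same
  manifold are diffeomorphic): `Literature.Topology.FourManifolds.BoundaryData.nonempty_diffeomorph_holds`;
* whence `Literature.Topology.FourManifolds.IsBoundaryGluing.transfer`: `P = C₂ ∪_φ W` and `g : C₁ ≅ C₂` give
  `P = C₁ ∪_{φ ∘ ∂g} W`. (The tree's `Literature.Topology.FourManifolds.IsBoundaryGluing.comp_diffeomorph`,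
  `CerfGammaFourProofs.lean`, is the special case of a *self*-diffeomorphism of one piece; the
  smooth-embedding lemma `Manifold.IsSmoothEmbedding.comp_diffeomorph` used here is that file's.)

## Triage of `corkDecomposition` itself (D-0014 provefact)

SIZE XL. The printed proofs (Matveyev §§1–2; Kirby §§2–5) run: (K1) an h-cobordism `U⁵` between
simply connected closed 4-manifolds has a handle decomposition on `X₁ × I` with 2- and 3-handles
only and boundary matrix `id` (Smale's trading, Milnor 1965 §8); (K2) in the middle level the
ascending/descending 2-spheres lie in a compact sub-manifold built from a contractible `B_{1/2}`,
giving a compact contractible sub-h-cobordism `A ⊂ U` containing all handles, so `U ∖ int A` is a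
product and `X₁ = A₀ ∪ M`, `X₂ = A₁ ∪ M` (CFHS; Matveyev part 1; Kirby §3); (K3) `A` may be
enlarged so that `A₀ ≅ A₁` (Matveyev part 2, "Fact" `W₁ ∪_Σ −W₁ ≅ S⁴ ≅ W₁ ∪_Σ −W₂` by Kirby
calculus; Kirby Addendum (D)). None of the infrastructure (Morse functions and handle
decompositions of cobordisms, handle slides/cancellation, regular neighbourhoods, finger/Whitney
moves, surgery, Kirby calculus semantics) is proved in Mathlib or `Literature/` (the relevant
`Handles.lean`, `Morse.lean`, `KirbyCalculus.lean` entries are themselves named facts), and the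
intermediate objects (sub-h-cobordisms with corners, ascending/descending spheres) have no
vocabulary yet. Of the lower rungs, only the statable ones are vendored, in sibling files:
(K1) `Literature.Topology.FourManifolds.exists_isMorseFunction_two_three_of_isHCobordism` (`HCobordismHandles.lean`: 2- and
3-handles only) and (K1′) `Literature.Topology.FourManifolds.exists_middleLevel_isStabilization_of_isHCobordism`
(`HCobordismMiddleLevel.lean`: the middle level is `X₁ # k(S² × S²) ≅ X₂ # k(S² × S²)`, which
also yields Wall's stabilisation theorem). This file lands the top rung of the DAG,
`Matveyev1996_decomposition ⟹ corkDecomposition` (proved, §3), and states the node just below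
it, part 1 together with Matveyev's "Fact" (§4), from which part 2 follows in print by a
connected-sum manipulation needing boundary connected sums (not formalised).

## References

* R. Matveyev, *A decomposition of smooth simply-connected h-cobordant 4-manifolds*,
  J. Differential Geom. 44 (1996) 571–582; arXiv:dg-ga/9505001, Theorem of the Introduction
  (parts 1–2), p. 1, and its proof, pp. 1–4. [Matveyev1996]
* C. L. Curtis, M. H. Freedman, W.-C. Hsiang, R. Stong, *A decomposition theorem for h-cobordant
  smooth simply-connected compact 4-manifolds*, Invent. Math. 123 (1996) 343–348, Theorem.
  [CurtisFreedmanHsiangStong1996]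
* R. Kirby, *Akbulut's corks and h-cobordisms of smooth simply connected 4-manifolds*, Turkish
  J. Math. 20 (1996) 85–93; arXiv:math/9712231, Theorem, Addenda (A)–(D). [KirbyCorks1996]
* J. M. Lee, *Introduction to Smooth Manifolds* (2013), Thm. 5.11, Cor. 5.30, Prop. 5.51
  (restriction of smooth maps to embedded submanifolds; uniqueness of the smooth structure on
  the boundary). [LeeSmoothManifolds2013]
-/

open scoped Manifold ContDiff Topology
open Set Function

noncomputable section

namespace Literature.Topology.FourManifolds

universe u

/-- Local notation: `𝔼 n` is the model Euclidean space `EuclideanSpace ℝ (Fin n)`. -/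
local notation "𝔼 " n:arg => EuclideanSpace ℝ (Fin n)

/-- Local notation: `𝕊 n` is the unit sphere in `EuclideanSpace ℝ (Fin (n + 1))`, the standard
`n`-sphere with its Mathlib smooth manifold structure. -/
local notation "𝕊 " n:arg => (Metric.sphere (0 : EuclideanSpace ℝ (Fin (n + 1))) 1)

/-! ### §1 Restricting a diffeomorphism to boundary data -/

section Restrict

variable {E H E₀ H₀ E₀' H₀' : Type*} [NormedAddCommGroup E] [NormedSpace ℝ E] [TopologicalSpace H]
  [NormedAddCommGroup E₀] [NormedSpace ℝ E₀] [TopologicalSpace H₀]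
  [NormedAddCommGroup E₀'] [NormedSpace ℝ E₀'] [TopologicalSpace H₀']
  {I : ModelWithCorners ℝ E H} {I₀ : ModelWithCorners ℝ E₀ H₀} {I₀' : ModelWithCorners ℝ E₀' H₀'}
  {C₁ C₂ : Type u} [TopologicalSpace C₁] [ChartedSpace H C₁] [TopologicalSpace C₂]
  [ChartedSpace H C₂]

namespace BoundaryData

/-- A diffeomorphism `g : C₁ ≅ C₂` maps the image of any boundary datum of `C₁` into the image
of any boundary datum of `C₂` (invariance of the boundary, Mathlib `Diffeomorph.image_boundary`).
[folklore] -/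
theorem apply_incl_mem_range_incl (g : C₁ ≃ₘ⟮I, I⟯ C₂) (b₁ : BoundaryData I C₁ I₀)
    (b₂ : BoundaryData I C₂ I₀') (z : b₁.carrier) : g (b₁.incl z) ∈ range b₂.incl := by
  rw [b₂.range_incl, ← Diffeomorph.image_boundary (by simp) g]
  exact mem_image_of_mem g (b₁.incl_mem_boundary z)

/-- The restriction `∂g : ∂C₁ ≃ ∂C₂` of a diffeomorphism `g : C₁ ≅ C₂` to boundary data, as a
bijection: `∂g z = b₂.incl⁻¹ (g (b₁.incl z))`. [folklore] -/
def restrictEquiv (b₁ : BoundaryData I C₁ I₀) (b₂ : BoundaryData I C₂ I₀') (g : C₁ ≃ₘ⟮I, I⟯ C₂) :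
    b₁.carrier ≃ b₂.carrier where
  toFun z := (Equiv.ofInjective b₂.incl b₂.injective_incl).symm
    ⟨g (b₁.incl z), apply_incl_mem_range_incl g b₁ b₂ z⟩
  invFun w := (Equiv.ofInjective b₁.incl b₁.injective_incl).symm
    ⟨g.symm (b₂.incl w), apply_incl_mem_range_incl g.symm b₂ b₁ w⟩
  left_inv z := by
    apply b₁.injective_incl
    rw [Equiv.apply_ofInjective_symm b₁.injective_incl]
    simp only [Equiv.apply_ofInjective_symm b₂.injective_incl, Diffeomorph.symm_apply_apply]
  right_inv w := by
    apply b₂.injective_incl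
    rw [Equiv.apply_ofInjective_symm b₂.injective_incl]
    simp only [Equiv.apply_ofInjective_symm b₁.injective_incl, Diffeomorph.apply_symm_apply]

variable {b₁ : BoundaryData I C₁ I₀} {b₂ : BoundaryData I C₂ I₀'}

/-- Defining equation of `restrictEquiv`: `b₂.incl (∂g z) = g (b₁.incl z)`. [folklore] -/
@[simp]
theorem incl_restrictEquiv (g : C₁ ≃ₘ⟮I, I⟯ C₂) (z : b₁.carrier) :
    b₂.incl (b₁.restrictEquiv b₂ g z) = g (b₁.incl z) :=
  Equiv.apply_ofInjective_symm b₂.injective_incl _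

/-- The inverse of `∂g` is `∂(g⁻¹)`. [folklore] -/
theorem restrictEquiv_symm (g : C₁ ≃ₘ⟮I, I⟯ C₂) :
    (b₁.restrictEquiv b₂ g).symm = b₂.restrictEquiv b₁ g.symm :=
  rfl

/-- `∂g (∂(g⁻¹) w) = w`. [folklore] -/
@[simp]
theorem restrictEquiv_apply_restrictEquiv_symm (g : C₁ ≃ₘ⟮I, I⟯ C₂) (w : b₂.carrier) :
    b₁.restrictEquiv b₂ g (b₂.restrictEquiv b₁ g.symm w) = w :=
  (b₁.restrictEquiv b₂ g).apply_symm_apply w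

/-- `∂(g⁻¹) (∂g z) = z`. [folklore] -/
@[simp]
theorem restrictEquiv_symm_apply_restrictEquiv (g : C₁ ≃ₘ⟮I, I⟯ C₂) (z : b₁.carrier) :
    b₂.restrictEquiv b₁ g.symm (b₁.restrictEquiv b₂ g z) = z :=
  (b₁.restrictEquiv b₂ g).symm_apply_apply z

/-- Defining equation of `restrictEquiv⁻¹`: `b₁.incl (∂g⁻¹ w) = g⁻¹ (b₂.incl w)`. [folklore] -/
@[simp]
theorem incl_restrictEquiv_symm (g : C₁ ≃ₘ⟮I, I⟯ C₂) (w : b₂.carrier) :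
    b₁.incl ((b₁.restrictEquiv b₂ g).symm w) = g.symm (b₂.incl w) :=
  Equiv.apply_ofInjective_symm b₁.injective_incl _

/-- `∂g` is continuous: `b₂.incl ∘ ∂g = g ∘ b₁.incl` is, and `b₂.incl` is an embedding.
[folklore] -/
theorem continuous_restrictEquiv (g : C₁ ≃ₘ⟮I, I⟯ C₂) : Continuous (b₁.restrictEquiv b₂ g) := by
  rw [b₂.isSmoothEmbedding.isEmbedding.continuous_iff]
  have : b₂.incl ∘ (b₁.restrictEquiv b₂ g) = g ∘ b₁.incl := funext fun z => by simp
  rw [this]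
  exact g.continuous.comp b₁.continuous_incl

/-- `∂g` is smooth: `b₂.incl ∘ ∂g = g ∘ b₁.incl` is smooth and `b₂.incl` is an immersion, so
`∂g` is smooth by Mathlib's `ContMDiff.iff_comp_isImmersion` (Lee, *Introduction to Smooth
Manifolds* (2013), Cor. 5.30). [cite: LeeSmoothManifolds2013, Cor. 5.30] -/
theorem contMDiff_restrictEquiv (g : C₁ ≃ₘ⟮I, I⟯ C₂) :
    ContMDiff I₀ I₀' ∞ (b₁.restrictEquiv b₂ g) := by
  rw [ContMDiff.iff_comp_isImmersion b₂.isSmoothEmbedding.isImmersion]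
  refine ⟨continuous_restrictEquiv g, ?_⟩
  have : b₂.incl ∘ (b₁.restrictEquiv b₂ g) = g ∘ b₁.incl := funext fun z => by simp
  rw [this]
  exact g.contMDiff.comp b₁.isSmoothEmbedding.contMDiff

variable (b₁ b₂) in
/-- **Restriction of a diffeomorphism to the boundary.** A diffeomorphism `g : C₁ ≅ C₂` of
manifolds with boundary restricts to a diffeomorphism `∂g : ∂C₁ ≅ ∂C₂` of any boundary data,
characterised by `b₂.incl ∘ ∂g = g ∘ b₁.incl` (Lee, *Introduction to Smooth Manifolds* (2013),
Thm. 5.11 and Cor. 5.30; invariance of the boundary is Mathlib's `Diffeomorph.image_boundary`).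
[cite: LeeSmoothManifolds2013, Thm. 5.11 and Cor. 5.30] -/
def restrictDiffeomorph (g : C₁ ≃ₘ⟮I, I⟯ C₂) : b₁.carrier ≃ₘ⟮I₀, I₀'⟯ b₂.carrier where
  toEquiv := b₁.restrictEquiv b₂ g
  contMDiff_toFun := contMDiff_restrictEquiv g
  contMDiff_invFun := contMDiff_restrictEquiv g.symm

/-- `restrictDiffeomorph` is `restrictEquiv` as a function. [folklore] -/
@[simp]
theorem coe_restrictDiffeomorph (g : C₁ ≃ₘ⟮I, I⟯ C₂) :
    ⇑(b₁.restrictDiffeomorph b₂ g) = b₁.restrictEquiv b₂ g :=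
  rfl

/-- The inverse of `∂g` is `∂(g⁻¹)`. [folklore] -/
@[simp]
theorem restrictDiffeomorph_symm (g : C₁ ≃ₘ⟮I, I⟯ C₂) :
    (b₁.restrictDiffeomorph b₂ g).symm = b₂.restrictDiffeomorph b₁ g.symm :=
  rfl

/-- Defining equation of `restrictDiffeomorph`: `b₂.incl (∂g z) = g (b₁.incl z)`. [folklore] -/
theorem incl_restrictDiffeomorph (g : C₁ ≃ₘ⟮I, I⟯ C₂) (z : b₁.carrier) :
    b₂.incl (b₁.restrictDiffeomorph b₂ g z) = g (b₁.incl z) := by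
  simp

/-- **Discharge of the named fact `Literature.Topology.FourManifolds.BoundaryData.nonempty_diffeomorph`** (`Cobordism.lean`):
any two boundary data `b`, `b'` of the same charted space `M` (same boundary model `I₀`) are
diffeomorphic — restrict the identity diffeomorphism of `M`: `∂(id) : b.carrier ≅ b'.carrier`.
This is the uniqueness of the smooth structure of `∂M` as an embedded submanifold (Lee,
*Introduction to Smooth Manifolds* (2013), Thm. 5.11 and Prop. 5.51); no hypothesis on `M`
beyond `ChartedSpace` is needed, as in the fact.
[cite: LeeSmoothManifolds2013, Thm. 5.11 and Prop. 5.51] -/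
theorem nonempty_diffeomorph_holds {M : Type u} [TopologicalSpace M] [ChartedSpace H M] :
    BoundaryData.nonempty_diffeomorph (I := I) (M := M) (I₀ := I₀) :=
  fun b b' => ⟨b.restrictDiffeomorph b' (Diffeomorph.refl I M ∞)⟩

end BoundaryData

/-! ### §1c Transporting a gluing along a diffeomorphism of a piece -/

variable {EW HW EP HP E₁ H₁ : Type*} [NormedAddCommGroup EW] [NormedSpace ℝ EW]
  [TopologicalSpace HW] {IW : ModelWithCorners ℝ EW HW}
  [NormedAddCommGroup E₁] [NormedSpace ℝ E₁] [TopologicalSpace H₁] {I₁ : ModelWithCorners ℝ E₁ H₁}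
  [NormedAddCommGroup EP] [NormedSpace ℝ EP] [TopologicalSpace HP] {IP : ModelWithCorners ℝ EP HP}
  {W : Type u} [TopologicalSpace W] [ChartedSpace HW W]
  {P : Type*} [TopologicalSpace P] [ChartedSpace HP P]
  {b₁ : BoundaryData I C₁ I₀} {b₂ : BoundaryData I C₂ I₀'} {bW : BoundaryData IW W I₁}

/-- **Transport of a gluing along a diffeomorphism of a piece.** If `P = C₂ ∪_φ W` and
`g : C₁ ≅ C₂` is a diffeomorphism, then `P = C₁ ∪_{φ ∘ ∂g} W`: the piece embedding of `C₁` is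
`j_{C₂} ∘ g` (a smooth embedding by `Manifold.IsSmoothEmbedding.comp_diffeomorph` of
`CerfGammaFourProofs.lean`) and the seam is re-indexed by `∂g = b₁.restrictDiffeomorph b₂ g`.
The tree's `IsBoundaryGluing.comp_diffeomorph` is the case of a self-diffeomorphism `C₁ = C₂`,
`b₁ = b₂`. Hirsch, *Differential Topology* (1976), §8.2 (the glued manifold depends only on the
pieces up to diffeomorphism compatible with the gluing map). [folklore] -/
theorem IsBoundaryGluing.transfer [IsManifold I ∞ C₁] [IsManifold I ∞ C₂]
    {φ : b₂.carrier → bW.carrier} (g : C₁ ≃ₘ⟮I, I⟯ C₂) (h : IsBoundaryGluing b₂ bW φ IP P) :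
    IsBoundaryGluing b₁ bW (φ ∘ b₁.restrictDiffeomorph b₂ g) IP P := by
  obtain ⟨jA, jB, hA, hB, hU, hR⟩ := h
  have hs : Surjective (⇑g) := g.surjective
  refine ⟨jA ∘ g, jB, hA.comp_diffeomorph g, hB, ?_, fun a b => ?_⟩
  · rwa [hs.range_comp]
  · rw [comp_apply, hR (g a) b]
    constructor
    · rintro ⟨z, ha, hb⟩
      refine ⟨(b₁.restrictDiffeomorph b₂ g).symm z, g.injective ?_, ?_⟩
      · simpa using ha
      · simpa using hb
    · rintro ⟨z, rfl, hb⟩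
      exact ⟨b₁.restrictDiffeomorph b₂ g z, (BoundaryData.incl_restrictDiffeomorph g z).symm,
        by simpa using hb⟩

end Restrict

/-! ### §2 Matveyev's theorem, parts 1–2 minus the `H₂` clause (two-piece form) -/

/-- **Matveyev's decomposition theorem, parts 1–2 minus the `H₂` clause of part 1** (two-piece
form, otherwise as printed). If `X₁`, `X₂` are h-cobordant simply connected closed smooth
4-manifolds (Matveyev: "`U` a smooth 5-dimensional simply-connected h-cobordism with
`∂U = M₁ ⊔ (−M₂)`" — `U` is homotopy equivalent to `M₁` and to `M₂`, so it is simply connected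
iff they are), then there are smooth compact contractible 4-manifolds with boundary `W₁`, `W₂`,
a smooth compact 4-manifold with boundary `M`, and diffeomorphisms `φᵢ : ∂Wᵢ ≅ ∂M`
("`Σ = ∂W₁ = ∂W₂ = ∂M`") with `X₁ = W₁ ∪_{φ₁} M` and `X₂ = W₂ ∪_{φ₂} M` (part 1; Matveyev writes
`Mᵢ = M ♯_Σ Wᵢ`), and moreover `W₁` is diffeomorphic to `W₂` (part 2). The clause of part 1
that the decompositions are compatible in `H₂` with the homotopy equivalence `f_*` induced by
`U` is **omitted** (as in `Literature.Topology.FourManifolds.corkDecomposition`); the refinements "`τ = ∂g` an involution,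
`Wᵢ` Stein" (Kirby 1996, Addendum (D); Akbulut–Matveyev 1998) are later results and not part of
this statement. `Literature.Topology.FourManifolds.corkDecomposition` is the one-piece rephrasing
(`Literature.Topology.FourManifolds.corkDecomposition_of_matveyev1996`). Independently proved, in the sub-h-cobordism form of
part 1, by Curtis–Freedman–Hsiang–Stong (Invent. Math. 123 (1996), Theorem).
[cite: Matveyev1996, Theorem (Introduction), parts 1–2 minus the H₂ clause] -/
def Matveyev1996_decomposition : Prop :=
  ∀ (X₁ X₂ : Type u) [TopologicalSpace X₁] [T2Space X₁] [SecondCountableTopology X₁]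
    [ChartedSpace (𝔼 4) X₁] [IsManifold (𝓡 4) ∞ X₁] [CompactSpace X₁] [SimplyConnectedSpace X₁]
    [TopologicalSpace X₂] [T2Space X₂] [SecondCountableTopology X₂]
    [ChartedSpace (𝔼 4) X₂] [IsManifold (𝓡 4) ∞ X₂] [CompactSpace X₂] [SimplyConnectedSpace X₂],
    IsHCobordant 4 X₁ X₂ →
      ∃ (W₁ W₂ M : Type u)
        (_ : TopologicalSpace W₁) (_ : T2Space W₁) (_ : SecondCountableTopology W₁)
        (_ : ChartedSpace (EuclideanHalfSpace 4) W₁) (_ : IsManifold (𝓡∂ 4) ∞ W₁)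
        (_ : TopologicalSpace W₂) (_ : T2Space W₂) (_ : SecondCountableTopology W₂)
        (_ : ChartedSpace (EuclideanHalfSpace 4) W₂) (_ : IsManifold (𝓡∂ 4) ∞ W₂)
        (_ : TopologicalSpace M) (_ : T2Space M) (_ : SecondCountableTopology M)
        (_ : ChartedSpace (EuclideanHalfSpace 4) M) (_ : IsManifold (𝓡∂ 4) ∞ M)
        (b₁ : BoundaryData (𝓡∂ 4) W₁ (𝓡 3)) (b₂ : BoundaryData (𝓡∂ 4) W₂ (𝓡 3))
        (bM : BoundaryData (𝓡∂ 4) M (𝓡 3))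
        (φ₁ : b₁.carrier ≃ₘ⟮𝓡 3, 𝓡 3⟯ bM.carrier) (φ₂ : b₂.carrier ≃ₘ⟮𝓡 3, 𝓡 3⟯ bM.carrier),
        CompactSpace W₁ ∧ ContractibleSpace W₁ ∧ CompactSpace W₂ ∧ ContractibleSpace W₂ ∧
        CompactSpace M ∧
        IsBoundaryGluing b₁ bM φ₁ (𝓡 4) X₁ ∧ IsBoundaryGluing b₂ bM φ₂ (𝓡 4) X₂ ∧
        Nonempty (W₁ ≃ₘ⟮𝓡∂ 4, 𝓡∂ 4⟯ W₂)

/-! ### §3 The reduction `Matveyev ⟹ corkDecomposition` (and back, up to the exterior's instances) -/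

/-- **`corkDecomposition` is equivalent to the weak two-piece form of Matveyev's theorem**
(faithfulness certificate for the one-piece phrasing). The right-hand side is
`Literature.Topology.FourManifolds.Matveyev1996_decomposition` (parts 1–2 minus the `H₂` clause) recording on the common
exterior `M` only what `Literature.Topology.FourManifolds.IsCorkTwist` records on its exterior (a topology, an atlas on the
half-space model and a boundary datum — no separation, countability, smoothness or compactness
conclusions); it is an intermediate reformulation, deliberately not a named definition (see the
module docstring, Merge note), and is implied by the printed form by forgetting those instances
(`Literature.Topology.FourManifolds.corkDecomposition_of_matveyev1996`).
`→`: the one-piece form gives the two-piece form with `W₁ = W₂ = C`, `g = id`, `φ₁ = φ`,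
`φ₂ = φ ∘ τ`. `←`: given `X₁ = W₁ ∪_{φ₁} M`, `X₂ = W₂ ∪_{φ₂} M` and `g : W₁ ≅ W₂`, transport the
second gluing along `g` (`IsBoundaryGluing.transfer`): `X₂ = W₁ ∪_{φ₂ ∘ ∂g} M`; with `C = W₁`,
exterior `M`, `φ = φ₁` and the twist `τ = ∂g ≫ φ₂ ≫ φ₁⁻¹ : ∂C ≅ ∂C` one has `φ ∘ τ = φ₂ ∘ ∂g`,
i.e. `IsCorkTwist b₁ τ (𝓡 4) X₁ (𝓡 4) X₂`. [folklore] -/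
theorem corkDecomposition_iff_matveyev1996Weak :
    corkDecomposition.{u} ↔
      ∀ (X₁ X₂ : Type u) [TopologicalSpace X₁] [T2Space X₁] [SecondCountableTopology X₁]
        [ChartedSpace (𝔼 4) X₁] [IsManifold (𝓡 4) ∞ X₁] [CompactSpace X₁] [SimplyConnectedSpace X₁]
        [TopologicalSpace X₂] [T2Space X₂] [SecondCountableTopology X₂]
        [ChartedSpace (𝔼 4) X₂] [IsManifold (𝓡 4) ∞ X₂] [CompactSpace X₂] [SimplyConnectedSpace X₂],
        IsHCobordant 4 X₁ X₂ →
          ∃ (W₁ W₂ M : Type u)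
            (_ : TopologicalSpace W₁) (_ : T2Space W₁) (_ : SecondCountableTopology W₁)
            (_ : ChartedSpace (EuclideanHalfSpace 4) W₁) (_ : IsManifold (𝓡∂ 4) ∞ W₁)
            (_ : TopologicalSpace W₂) (_ : T2Space W₂) (_ : SecondCountableTopology W₂)
            (_ : ChartedSpace (EuclideanHalfSpace 4) W₂) (_ : IsManifold (𝓡∂ 4) ∞ W₂)
            (_ : TopologicalSpace M) (_ : ChartedSpace (EuclideanHalfSpace 4) M)
            (b₁ : BoundaryData (𝓡∂ 4) W₁ (𝓡 3)) (b₂ : BoundaryData (𝓡∂ 4) W₂ (𝓡 3))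
            (bM : BoundaryData (𝓡∂ 4) M (𝓡 3))
            (φ₁ : b₁.carrier ≃ₘ⟮𝓡 3, 𝓡 3⟯ bM.carrier) (φ₂ : b₂.carrier ≃ₘ⟮𝓡 3, 𝓡 3⟯ bM.carrier),
            CompactSpace W₁ ∧ ContractibleSpace W₁ ∧ CompactSpace W₂ ∧ ContractibleSpace W₂ ∧
            IsBoundaryGluing b₁ bM φ₁ (𝓡 4) X₁ ∧ IsBoundaryGluing b₂ bM φ₂ (𝓡 4) X₂ ∧
            Nonempty (W₁ ≃ₘ⟮𝓡∂ 4, 𝓡∂ 4⟯ W₂) := by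
  constructor
  · intro h X₁ X₂ _ _ _ _ _ _ _ _ _ _ _ _ _ _ hcob
    obtain ⟨C, _, _, _, _, _, bC, τ, hc, hk, W, _, _, bW, φ, hX₁, hX₂⟩ := h X₁ X₂ hcob
    exact ⟨C, C, W, ‹_›, ‹_›, ‹_›, ‹_›, ‹_›, ‹_›, ‹_›, ‹_›, ‹_›, ‹_›, ‹_›, ‹_›, bC, bC, bW, φ,
      τ.trans φ, hc, hk, hc, hk, hX₁, hX₂, ⟨Diffeomorph.refl _ C _⟩⟩
  · intro h X₁ X₂ _ _ _ _ _ _ _ _ _ _ _ _ _ _ hcob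
    obtain ⟨W₁, W₂, M, _, _, _, _, _, _, _, _, _, _, _, _, b₁, b₂, bM, φ₁, φ₂, hc₁, hk₁, -, -, hX₁,
      hX₂, ⟨g⟩⟩ := h X₁ X₂ hcob
    refine ⟨W₁, ‹_›, ‹_›, ‹_›, ‹_›, ‹_›, b₁, (b₁.restrictDiffeomorph b₂ g).trans (φ₂.trans φ₁.symm),
      hc₁, hk₁, M, ‹_›, ‹_›, bM, φ₁, hX₁, ?_⟩
    exact isBoundaryGluing_congr (fun z => by simp) (hX₂.transfer g)

/-- **Matveyev's theorem (parts 1–2 minus the `H₂` clause) implies `Literature.Topology.FourManifolds.corkDecomposition`**: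
forget the separation, countability, smoothness and compactness of the exterior `M` and apply
`Literature.Topology.FourManifolds.corkDecomposition_iff_matveyev1996Weak` (`←`: transport the second gluing along
`g : W₁ ≅ W₂`, `C = W₁`, `τ = ∂g ≫ φ₂ ≫ φ₁⁻¹`).
[cite: Matveyev1996, Theorem (Introduction), parts 1–2 minus the H₂ clause] -/
theorem corkDecomposition_of_matveyev1996 (h : Matveyev1996_decomposition.{u}) :
    corkDecomposition.{u} := by
  refine corkDecomposition_iff_matveyev1996Weak.2 ?_
  intro X₁ X₂ _ _ _ _ _ _ _ _ _ _ _ _ _ _ hcob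
  obtain ⟨W₁, W₂, M, _, _, _, _, _, _, _, _, _, _, _, _, _, _, _, b₁, b₂, bM, φ₁, φ₂, hc₁, hk₁, hc₂,
    hk₂, -, hX₁, hX₂, hg⟩ := h X₁ X₂ hcob
  exact ⟨W₁, W₂, M, ‹_›, ‹_›, ‹_›, ‹_›, ‹_›, ‹_›, ‹_›, ‹_›, ‹_›, ‹_›, ‹_›, ‹_›, b₁, b₂, bM, φ₁, φ₂,
    hc₁, hk₁, hc₂, hk₂, hX₁, hX₂, hg⟩

/-! ### §4 One rung down: part 1 together with the "Fact" of the proof of part 2 -/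

/-- **Matveyev's Theorem, part 1 (minus the `H₂` clause), together with the "Fact" on which
the proof of part 2 rests** — the next node below `Matveyev1996_decomposition` in the DAG of
`corkDecomposition`. Printed (arXiv:dg-ga/9505001, Theorem part 1, and p. 3, "Proof of the
second part is based on the **Fact.** *If `W₁`, `W₂` are homotopy balls built in the proof of
the first part of Theorem and `S⁴` is a 4-dimensional sphere with standard smooth structure,
then `W₁ ♯_Σ W₁ ≅ S⁴`, `W₁ ♯_Σ W₂ ≅ S⁴`.*"): since the Fact concerns the particular pieces
constructed in the proof of part 1, the faithful vendoring is the *bundled existential*: for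
h-cobordant simply connected closed smooth `X₁`, `X₂` there are decompositions
`X₁ = W₁ ∪_{φ₁} M`, `X₂ = W₂ ∪_{φ₂} M` as in part 1 (`Wᵢ` smooth compact contractible, `M`
smooth compact, `Σ = ∂W₁ =_{φ₁} ∂M =_{φ₂} ∂W₂`) such that moreover the standard `S⁴` is the
double `W₁ ∪_{id} W₁` of `W₁` and the gluing `W₁ ∪_{φ₂⁻¹ ∘ φ₁} W₂` of `W₁` and `W₂` along the
identification of their boundaries through `Σ`. "`≅ S⁴`" is rendered relationally on the
concrete sphere `𝕊 4` (as the tree's `Literature.Topology.FourManifolds.isDouble_sphere`), which is equivalent to the printed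
"some (any) model of the gluing is diffeomorphic to `S⁴`" by existence, uniqueness and transport
of gluings. Part 2 (`W₁ ≅ W₂`, i.e. `Matveyev1996_decomposition`) follows from this node by
Matveyev's chain (p. 3, ll. after the Fact, fig. 2)
`M₁ ≅ (M ♯_Σ W₁) # (W₁ ♯_Σ W₂) ≅ (M ♮ W₁) ♯_{Σ#Σ} (W₁ ♮ W₂)`,
`M₂ ≅ (M ♯_Σ W₂) # (W₁ ♯_Σ W₁) ≅ (M ♮ W₁) ♯_{Σ#Σ} (W₂ ♮ W₁)`, which needs boundary connected
sums and is not formalised here (see the module docstring, "Triage"). Not implied by, and not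
implying, `Matveyev1996_decomposition` formally.
[cite: Matveyev1996, Theorem part 1 (minus the H₂ clause) and the Fact of the proof of part 2 (p. 3)] -/
def Matveyev1996_partOne_and_fact : Prop :=
  ∀ (X₁ X₂ : Type u) [TopologicalSpace X₁] [T2Space X₁] [SecondCountableTopology X₁]
    [ChartedSpace (𝔼 4) X₁] [IsManifold (𝓡 4) ∞ X₁] [CompactSpace X₁] [SimplyConnectedSpace X₁]
    [TopologicalSpace X₂] [T2Space X₂] [SecondCountableTopology X₂]
    [ChartedSpace (𝔼 4) X₂] [IsManifold (𝓡 4) ∞ X₂] [CompactSpace X₂] [SimplyConnectedSpace X₂],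
    IsHCobordant 4 X₁ X₂ →
      ∃ (W₁ W₂ M : Type u)
        (_ : TopologicalSpace W₁) (_ : T2Space W₁) (_ : SecondCountableTopology W₁)
        (_ : ChartedSpace (EuclideanHalfSpace 4) W₁) (_ : IsManifold (𝓡∂ 4) ∞ W₁)
        (_ : TopologicalSpace W₂) (_ : T2Space W₂) (_ : SecondCountableTopology W₂)
        (_ : ChartedSpace (EuclideanHalfSpace 4) W₂) (_ : IsManifold (𝓡∂ 4) ∞ W₂)
        (_ : TopologicalSpace M) (_ : T2Space M) (_ : SecondCountableTopology M)
        (_ : ChartedSpace (EuclideanHalfSpace 4) M) (_ : IsManifold (𝓡∂ 4) ∞ M)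
        (b₁ : BoundaryData (𝓡∂ 4) W₁ (𝓡 3)) (b₂ : BoundaryData (𝓡∂ 4) W₂ (𝓡 3))
        (bM : BoundaryData (𝓡∂ 4) M (𝓡 3))
        (φ₁ : b₁.carrier ≃ₘ⟮𝓡 3, 𝓡 3⟯ bM.carrier) (φ₂ : b₂.carrier ≃ₘ⟮𝓡 3, 𝓡 3⟯ bM.carrier),
        CompactSpace W₁ ∧ ContractibleSpace W₁ ∧ CompactSpace W₂ ∧ ContractibleSpace W₂ ∧
        CompactSpace M ∧
        IsBoundaryGluing b₁ bM φ₁ (𝓡 4) X₁ ∧ IsBoundaryGluing b₂ bM φ₂ (𝓡 4) X₂ ∧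
        IsDouble b₁ (𝓡 4) (𝕊 4) ∧ IsBoundaryGluing b₁ b₂ (φ₁.trans φ₂.symm) (𝓡 4) (𝕊 4)

/-- The bundled node yields in particular part 1 alone (the two-piece decomposition without
`W₁ ≅ W₂`; also Curtis–Freedman–Hsiang–Stong 1996, Theorem, in end form): forget the Fact.
[cite: Matveyev1996, Theorem part 1 (minus the H₂ clause)] -/
theorem Matveyev1996_partOne_and_fact.partOne (h : Matveyev1996_partOne_and_fact.{u})
    {X₁ X₂ : Type u} [TopologicalSpace X₁] [T2Space X₁] [SecondCountableTopology X₁]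
    [ChartedSpace (𝔼 4) X₁] [IsManifold (𝓡 4) ∞ X₁] [CompactSpace X₁] [SimplyConnectedSpace X₁]
    [TopologicalSpace X₂] [T2Space X₂] [SecondCountableTopology X₂]
    [ChartedSpace (𝔼 4) X₂] [IsManifold (𝓡 4) ∞ X₂] [CompactSpace X₂] [SimplyConnectedSpace X₂]
    (hcob : IsHCobordant 4 X₁ X₂) :
    ∃ (W₁ W₂ M : Type u)
      (_ : TopologicalSpace W₁) (_ : T2Space W₁) (_ : SecondCountableTopology W₁)
      (_ : ChartedSpace (EuclideanHalfSpace 4) W₁) (_ : IsManifold (𝓡∂ 4) ∞ W₁)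
      (_ : TopologicalSpace W₂) (_ : T2Space W₂) (_ : SecondCountableTopology W₂)
      (_ : ChartedSpace (EuclideanHalfSpace 4) W₂) (_ : IsManifold (𝓡∂ 4) ∞ W₂)
      (_ : TopologicalSpace M) (_ : T2Space M) (_ : SecondCountableTopology M)
      (_ : ChartedSpace (EuclideanHalfSpace 4) M) (_ : IsManifold (𝓡∂ 4) ∞ M)
      (b₁ : BoundaryData (𝓡∂ 4) W₁ (𝓡 3)) (b₂ : BoundaryData (𝓡∂ 4) W₂ (𝓡 3))
      (bM : BoundaryData (𝓡∂ 4) M (𝓡 3))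
      (φ₁ : b₁.carrier ≃ₘ⟮𝓡 3, 𝓡 3⟯ bM.carrier) (φ₂ : b₂.carrier ≃ₘ⟮𝓡 3, 𝓡 3⟯ bM.carrier),
      CompactSpace W₁ ∧ ContractibleSpace W₁ ∧ CompactSpace W₂ ∧ ContractibleSpace W₂ ∧
      CompactSpace M ∧
      IsBoundaryGluing b₁ bM φ₁ (𝓡 4) X₁ ∧ IsBoundaryGluing b₂ bM φ₂ (𝓡 4) X₂ := by
  obtain ⟨W₁, W₂, M, _, _, _, _, _, _, _, _, _, _, _, _, _, _, _, b₁, b₂, bM, φ₁, φ₂, hc₁, hk₁, hc₂,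
    hk₂, hcM, hX₁, hX₂, -, -⟩ := h X₁ X₂ hcob
  exact ⟨W₁, W₂, M, ‹_›, ‹_›, ‹_›, ‹_›, ‹_›, ‹_›, ‹_›, ‹_›, ‹_›, ‹_›, ‹_›, ‹_›, ‹_›, ‹_›, ‹_›, b₁, b₂,
    bM, φ₁, φ₂, hc₁, hk₁, hc₂, hk₂, hcM, hX₁, hX₂⟩

/-- In the bundled node the "Fact" also gives `S⁴` as a gluing `W₂ ∪ W₁` (symmetry of gluing
along the boundary, `IsBoundaryGluing.symm'`), the form in which it enters the chain for `M₂`.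
[folklore] -/
theorem Matveyev1996_partOne_and_fact.sphere_isBoundaryGluing_symm
    {W₁ W₂ : Type u} [TopologicalSpace W₁] [ChartedSpace (EuclideanHalfSpace 4) W₁]
    [TopologicalSpace W₂] [ChartedSpace (EuclideanHalfSpace 4) W₂]
    {b₁ : BoundaryData (𝓡∂ 4) W₁ (𝓡 3)} {b₂ : BoundaryData (𝓡∂ 4) W₂ (𝓡 3)}
    {ψ : b₁.carrier ≃ₘ⟮𝓡 3, 𝓡 3⟯ b₂.carrier} (h : IsBoundaryGluing b₁ b₂ ψ (𝓡 4) (𝕊 4)) :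
    IsBoundaryGluing b₂ b₁ ψ.symm (𝓡 4) (𝕊 4) :=
  h.symm'

end Literature.Topology.FourManifolds

end
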